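import Mathlib
import HarnessLib
import Literature.MathematicalPhysics.QuantumLattice.SectorisedKernelNormPrescribedSums
import Literature.MathematicalPhysics.QuantumLattice.GrassmannKernelsPresented
import Summits.HubbardSuperconductivity.HubbardSuperconductivity.Theorems.KLProgrammeKLRegimeEngineKernelNormsWt4
import Summits.HubbardSuperconductivity.HubbardSuperconductivity.Theorems.KLProgrammeKLRegimeKernelNormsLevelsDefs

/-!
# Route `KLProgramme` — crux K3 ENGINE (stmt-HubbardSuperconductivity-20437 `KLRegimeEngineV17F2`), stub (b): the blocked-tower bookkeeping,
# part 13 — the READ-OUT IN MODEL CURRENCY: the two level-`j` currencies of conjunct 2 are subadditive in the carrier, so a decomposition of the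
# scale-`j` action into increments with separately bounded sizes gives `KernelNormsWt4` / `KernelNormsLevels` at the summed budget
# (E1 lead r2d-p2 g8; memo E1-TOWER-BLOCKED §2 last paragraph / §9 «read-out by T1′ + one partial-block step», dimensionless twin = part 7 `towerReadout_le`)

The one-shot blocked tower at the frame `K` never bounds the scale-`j` action `𝒱_j[K] = klEffectiveAction L M β U μ K klE0 j` directly: it bounds the
INCREMENTS `Δ^{[k]} = 𝒱_{J_k} − 𝒱_{J_{k−1}}` born at the block boundaries (and the partial-block increment `𝒱_j − 𝒱_{J_k}`), each re-measured in the
level-`j` family.  What conjunct 2 of stub (b) reads at level `j` are two SUBADDITIVE functionals of the carrier: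

* the WEIGHTED PINNED SUMS `klWtPinnedSum L M β U μ K j m q w = ε_x^{m−1} Σ_{X : X q = w} klScaleWt_j(pos X)·‖kernel (map (toLin' E_j) 𝒱_j) m X‖` (`KernelNormsWt4`), and
* the LEVELLED sectorised norms `klAnisoLegKernelNormAt … j (2p) Ωe = hubbardSectorKernelNorm … (prescribedTuples (bgmSectorSet …) Ωe) 𝒱_j` (`KernelNormsLevels`),

both written here for an ARBITRARY Grassmann element in place of `𝒱_j` (no definition is introduced; the expressions are spelled out, as in k3c2-p3's
…SectorisedKernelNormPrescribedSums).  This file is the glue between the tower's per-increment sizes and the registered text: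

* §1 `wtPinnedSum_sum_le` — the weighted pinned sum of a finite sum of Grassmann elements is at most the sum of theirs (`map_sum`, `kernel_sum`,
  `norm_sum_le`); `klWtPinnedSum_eq_wtPinnedSum` (`rfl` bridge); `hubbardSectorKernelNorm_sum_le` — the sectorised `L¹–L^∞` norm (any multiplier family,
  any constraint set) of a finite sum is at most the sum of the norms (from the tree's `hubbardSectorKernelNorm_add_le`);
* §2 **`kernelNormsWt4_of_decomposition`** — if `𝒱_j[K] = Σ_{i ∈ s} T i` and every increment's level-`j` weighted pinned sums in degree `m ≠ 2` are `≤ a i m`,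
  then `KernelNormsWt4 L M (fun m => Σ_{i∈s} a i m) β U μ K j`; **`kernelNormsWt4_klWtBudget_of_decomposition`** — the same landed inside the E1 budget when
  `Σ_i a i m ≤ klWtBudget P Q U j m`; **`kernelNormsLevels_of_decomposition`** — if every increment's levelled norm at prescription `Ωe` of the `2p` legs is
  `≤ b i p (levelCount Ωe)` and `Σ_i b i p F` fits under the levels law `CE^p ε_j^{p−1} 2^{(3p−5)j} (2^{−j})^{levelGainExp F}`, then `KernelNormsLevels L M P Q β U μ K j`;
* §3 the carrier's decompositions (abelian-group telescoping, for the tower's increment indexing): `klEffectiveAction_eq_zero_add_sum_sub` (unit steps) and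
  **`klEffectiveAction_eq_blocked`** — for a block length `d`: `𝒱_j = 𝒱_0 + Σ_{k < j/d} (𝒱_{d(k+1)} − 𝒱_{dk}) + (𝒱_j − 𝒱_{d·(j/d)})` (the born increments at the
  boundaries `J_k = dk` plus the partial-block increment).

Pure bookkeeping (linearity of `map`/`kernel`, the triangle inequality, telescoping); nothing about the model is asserted; nothing asserts superconductivity.
NOT here: the per-increment sizes themselves (re-measurement = k3c2-p3's jump/re-sectorisation suppliers; birth = the weighted/prescribed Grassmann steps) and the
dimensionless → dimensional units conversion (next part).
References: BGM 2006 §2.8 (2.76)–(2.83), (2.93)–(2.98) [cite: BenfattoGiulianiMastropietro2006].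
-/

noncomputable section

namespace Summit.HubbardSuperconductivity.HubbardSuperconductivity.Theorems.EngineV8

set_option linter.dupNamespace false -- summit = problem name (single-conjunct summit), D-0017

open Real Finset Literature.MathematicalPhysics.QuantumLattice Literature.Probability.LatticeModels GrassmannAlgebra
open Summit.HubbardSuperconductivity.HubbardSuperconductivity.Theorems.KLProgrammeLegKernels
open Summit.HubbardSuperconductivity.HubbardSuperconductivity.Theorems.KLRegimeSplit

variable {L M : ℕ} [NeZero L]

/-! ## §1 Subadditivity of the two level-`j` currencies in the carrier -/

/-- **The weighted pinned sum of a finite sum of Grassmann elements is at most the sum of theirs** (any frame `K`, level `j`, degree `m`, pinned leg `q`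
at `w`): linearity of the analysis map and of `kernel`, then the triangle inequality under the nonnegative weights. -/
theorem wtPinnedSum_sum_le {β : ℝ} (hβ : 0 ≤ β) (μ : ℝ) (K : TrigPolyC4v) (j m : ℕ) {ι : Type*} (s : Finset ι) (T : ι → HubbardGrassmann L M)
    (q : Fin m) (w : SpaceTimeIdx L M × SectorLeg (sectorCount j)) :
    imagTimeWeight β M ^ (m - 1) *
        ∑ X ∈ univ.filter (fun X : Fin m → SpaceTimeIdx L M × SectorLeg (sectorCount j) => X q = w),
          klScaleWt L M β j ((univ.image X).image (latticeLegPos (2 * (2 * M)))) *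
            ‖kernel ℂ (ExteriorAlgebra.map (Matrix.toLin' (sectorAnalysisMatrix L M β (klAnisoFamily L M β μ K klE0 j)))
                (∑ i ∈ s, T i)) m X‖ ≤
      ∑ i ∈ s, imagTimeWeight β M ^ (m - 1) *
        ∑ X ∈ univ.filter (fun X : Fin m → SpaceTimeIdx L M × SectorLeg (sectorCount j) => X q = w),
          klScaleWt L M β j ((univ.image X).image (latticeLegPos (2 * (2 * M)))) *
            ‖kernel ℂ (ExteriorAlgebra.map (Matrix.toLin' (sectorAnalysisMatrix L M β (klAnisoFamily L M β μ K klE0 j))) (T i)) m X‖ := by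
  rw [← mul_sum, sum_comm]
  refine mul_le_mul_of_nonneg_left (sum_le_sum fun X _ => ?_) (pow_nonneg (imagTimeWeight_nonneg hβ M) _)
  rw [← mul_sum]
  refine mul_le_mul_of_nonneg_left ?_ (zero_le_one.trans (one_le_klScaleWt L M β j _))
  rw [map_sum, kernel_sum]
  exact norm_sum_le _ _

/-- `klWtPinnedSum` IS the weighted pinned sum of the scale-`j` action `klEffectiveAction … K klE0 j` (`rfl` bridge to §1's spelled-out form). -/
theorem klWtPinnedSum_eq_wtPinnedSum (β U μ : ℝ) (K : TrigPolyC4v) (j m : ℕ) (q : Fin m) (w : SpaceTimeIdx L M × SectorLeg (sectorCount j)) :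
    klWtPinnedSum L M β U μ K j m q w = imagTimeWeight β M ^ (m - 1) *
      ∑ X ∈ univ.filter (fun X : Fin m → SpaceTimeIdx L M × SectorLeg (sectorCount j) => X q = w),
        klScaleWt L M β j ((univ.image X).image (latticeLegPos (2 * (2 * M)))) *
          ‖kernel ℂ (ExteriorAlgebra.map (Matrix.toLin' (sectorAnalysisMatrix L M β (klAnisoFamily L M β μ K klE0 j)))
              (klEffectiveAction L M β U μ K klE0 j)) m X‖ := rfl

/-- **The sectorised `L¹–L^∞` norm of a finite sum is at most the sum of the norms** (any multiplier family `F`, any constraint set `A`; from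
`hubbardSectorKernelNorm_add_le`). -/
theorem hubbardSectorKernelNorm_sum_le {Ns : ℕ} {β : ℝ} (hβ : 0 ≤ β) (F : Fin Ns → FreqMomentum L M → ℂ) {m : ℕ}
    (A : Finset (Fin m → SectorLeg Ns)) {ι : Type*} (s : Finset ι) (T : ι → HubbardGrassmann L M) :
    hubbardSectorKernelNorm L M β F A (∑ i ∈ s, T i) ≤ ∑ i ∈ s, hubbardSectorKernelNorm L M β F A (T i) := by
  classical
  induction s using Finset.induction_on with
  | empty => simp
  | insert i s hi ih =>
    rw [sum_insert hi, sum_insert hi]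
    exact (hubbardSectorKernelNorm_add_le hβ F A _ _).trans (by gcongr)

/-! ## §2 The read-out: conjunct 2's two clauses at level `j` from a decomposition of the scale-`j` action -/

section Readout

/-- **`KernelNormsWt4` at level `j` from a decomposition** `𝒱_j[K] = Σ_{i ∈ s} T i` with per-increment weighted pinned sums `≤ a i m` in every degree
`m ≠ 2` (all pins): the profile holds at the SUMMED budget `m ↦ Σ_i a i m`. -/
theorem kernelNormsWt4_of_decomposition {β : ℝ} (hβ : 0 ≤ β) {U μ : ℝ} {K : TrigPolyC4v} {j : ℕ} {ι : Type*} {s : Finset ι}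
    {T : ι → HubbardGrassmann L M} (hT : klEffectiveAction L M β U μ K klE0 j = ∑ i ∈ s, T i) {a : ι → ℕ → ℝ}
    (ha : ∀ i ∈ s, ∀ m : ℕ, m ≠ 2 → ∀ (q : Fin m) (w : SpaceTimeIdx L M × SectorLeg (sectorCount j)),
      imagTimeWeight β M ^ (m - 1) *
        ∑ X ∈ univ.filter (fun X : Fin m → SpaceTimeIdx L M × SectorLeg (sectorCount j) => X q = w),
          klScaleWt L M β j ((univ.image X).image (latticeLegPos (2 * (2 * M)))) *
            ‖kernel ℂ (ExteriorAlgebra.map (Matrix.toLin' (sectorAnalysisMatrix L M β (klAnisoFamily L M β μ K klE0 j))) (T i)) m X‖ ≤ a i m) :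
    KernelNormsWt4 L M (fun m => ∑ i ∈ s, a i m) β U μ K j := by
  intro m hm q w
  rw [klWtPinnedSum_eq_wtPinnedSum, hT]
  exact (wtPinnedSum_sum_le hβ μ K j m s T q w).trans (sum_le_sum fun i hi => ha i hi m hm q w)

/-- **… inside the E1 budget**: if moreover `Σ_i a i m ≤ klWtBudget P Q U j m` in every degree `m ≠ 2`, then
`KernelNormsWt4 L M (klWtBudget P Q U j) β U μ K j` — conjunct 2's weighted clause at level `j` as registered. -/
theorem kernelNormsWt4_klWtBudget_of_decomposition {β : ℝ} (hβ : 0 ≤ β) {U μ : ℝ} {K : TrigPolyC4v} {j : ℕ} {ι : Type*} {s : Finset ι}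
    {T : ι → HubbardGrassmann L M} (hT : klEffectiveAction L M β U μ K klE0 j = ∑ i ∈ s, T i) {a : ι → ℕ → ℝ}
    (ha : ∀ i ∈ s, ∀ m : ℕ, m ≠ 2 → ∀ (q : Fin m) (w : SpaceTimeIdx L M × SectorLeg (sectorCount j)),
      imagTimeWeight β M ^ (m - 1) *
        ∑ X ∈ univ.filter (fun X : Fin m → SpaceTimeIdx L M × SectorLeg (sectorCount j) => X q = w),
          klScaleWt L M β j ((univ.image X).image (latticeLegPos (2 * (2 * M)))) *
            ‖kernel ℂ (ExteriorAlgebra.map (Matrix.toLin' (sectorAnalysisMatrix L M β (klAnisoFamily L M β μ K klE0 j))) (T i)) m X‖ ≤ a i m)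
    {P : SplitConsts} {Q : EngConsts} (hfit : ∀ m : ℕ, m ≠ 2 → ∑ i ∈ s, a i m ≤ klWtBudget P Q U j m) :
    KernelNormsWt4 L M (klWtBudget P Q U j) β U μ K j :=
  fun m hm q w => (kernelNormsWt4_of_decomposition hβ hT ha m hm q w).trans (hfit m hm)

/-- **`KernelNormsLevels` at level `j` from a decomposition** `𝒱_j[K] = Σ_{i ∈ s} T i` with per-increment LEVELLED norms `≤ b i p F` at every prescription
`Ωe` of the `2p` legs with `levelCount Ωe = F` (`p ≥ 3`), summing under the levels law:
`Σ_i b i p F ≤ CE^p · ε_j^{p−1} · 2^{(3p−5)j} · (2^{−j})^{levelGainExp F}`. -/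
theorem kernelNormsLevels_of_decomposition {β : ℝ} (hβ : 0 ≤ β) {U μ : ℝ} {K : TrigPolyC4v} {j : ℕ} {ι : Type*} {s : Finset ι}
    {T : ι → HubbardGrassmann L M} (hT : klEffectiveAction L M β U μ K klE0 j = ∑ i ∈ s, T i) {b : ι → ℕ → ℕ → ℝ}
    (hb : ∀ i ∈ s, ∀ p : ℕ, 3 ≤ p → ∀ Ωe : Fin (2 * p) → Option (SectorLeg (sectorCount j)),
      hubbardSectorKernelNorm L M β (klAnisoFamily L M β μ K klE0 j)
        (prescribedTuples (bgmSectorSet L M (klAnisoFamily L M β μ K klE0 j) (2 * p)) Ωe) (T i) ≤ b i p (levelCount Ωe))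
    {P : SplitConsts} {Q : EngConsts}
    (hfit : ∀ p : ℕ, 3 ≤ p → ∀ F : ℕ, ∑ i ∈ s, b i p F ≤
      Q.CE ^ p * (epsCoupling P U j) ^ (p - 1) * (2 : ℝ) ^ ((3 * (p : ℤ) - 5) * j) * (((2 : ℝ) ^ j)⁻¹) ^ levelGainExp F) :
    KernelNormsLevels L M P Q β U μ K j := by
  intro p hp Ωe
  rw [klAnisoLegKernelNormAt, hT]
  exact ((hubbardSectorKernelNorm_sum_le hβ _ _ s T).trans (sum_le_sum fun i hi => hb i hi p hp Ωe)).trans (hfit p hp _)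

end Readout

/-! ## §3 The carrier's decompositions (the tower's increment indexing) -/

/-- Telescoping in an additive commutative group: `f j = f 0 + Σ_{i < j} (f (i+1) − f i)`. -/
private theorem eq_zero_add_sum_sub {G : Type*} [AddCommGroup G] (f : ℕ → G) (j : ℕ) :
    f j = f 0 + ∑ i ∈ range j, (f (i + 1) - f i) := by
  rw [sum_range_sub, add_sub_cancel]

/-- Blocked telescoping: for `0 < d`, `f j = f 0 + Σ_{k < j/d} (f (d(k+1)) − f (dk)) + (f j − f (d·(j/d)))`. -/
private theorem eq_blocked {G : Type*} [AddCommGroup G] (f : ℕ → G) (d j : ℕ) :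
    f j = f 0 + ∑ k ∈ range (j / d), (f (d * (k + 1)) - f (d * k)) + (f j - f (d * (j / d))) := by
  have h := sum_range_sub (fun k => f (d * k)) (j / d)
  simp only [mul_zero] at h
  rw [h]
  abel

/-- **Unit-step decomposition of the scale-`j` action at the frame `K`**: `𝒱_j = 𝒱_0 + Σ_{i < j} (𝒱_{i+1} − 𝒱_i)` (every cutoff unit `e₀`). -/
theorem klEffectiveAction_eq_zero_add_sum_sub (β U μ : ℝ) (K : TrigPolyC4v) (e₀ : ℝ) (j : ℕ) :
    klEffectiveAction L M β U μ K e₀ j = klEffectiveAction L M β U μ K e₀ 0 +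
      ∑ i ∈ range j, (klEffectiveAction L M β U μ K e₀ (i + 1) - klEffectiveAction L M β U μ K e₀ i) :=
  eq_zero_add_sum_sub (fun i => klEffectiveAction L M β U μ K e₀ i) j

/-- **BLOCKED decomposition of the scale-`j` action at the frame `K`** (block length `d`, boundaries `J_k = d·k`): the scale-`0` action, plus the born increments
`Δ^{[k+1]} = 𝒱_{d(k+1)} − 𝒱_{dk}` of the complete blocks below `j` (`k < j/d`), plus the partial-block increment `𝒱_j − 𝒱_{d·(j/d)}` (zero when `d ∣ j`):
`𝒱_j = 𝒱_0 + Σ_{k < j/d} (𝒱_{d(k+1)} − 𝒱_{dk}) + (𝒱_j − 𝒱_{d·(j/d)})`. -/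
theorem klEffectiveAction_eq_blocked (β U μ : ℝ) (K : TrigPolyC4v) (e₀ : ℝ) (d j : ℕ) :
    klEffectiveAction L M β U μ K e₀ j = klEffectiveAction L M β U μ K e₀ 0 +
      ∑ k ∈ range (j / d), (klEffectiveAction L M β U μ K e₀ (d * (k + 1)) - klEffectiveAction L M β U μ K e₀ (d * k)) +
        (klEffectiveAction L M β U μ K e₀ j - klEffectiveAction L M β U μ K e₀ (d * (j / d))) :=
  eq_blocked (fun i => klEffectiveAction L M β U μ K e₀ i) d j

/-- The partial-block increment vanishes at a boundary: `d ∣ j ⇒ 𝒱_j − 𝒱_{d·(j/d)} = 0`. -/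
theorem klEffectiveAction_sub_block_eq_zero (β U μ : ℝ) (K : TrigPolyC4v) (e₀ : ℝ) {d j : ℕ} (h : d ∣ j) :
    klEffectiveAction L M β U μ K e₀ j - klEffectiveAction L M β U μ K e₀ (d * (j / d)) = 0 := by
  rw [Nat.mul_div_cancel' h, sub_self]

/-- **The blocked decomposition as ONE finite sum** indexed by `Option (Fin (j/d + 1))` — `none` ↦ the scale-`0` action, `some k` (`k < j/d`) ↦ the born increment of
block `k+1`, `some (j/d)` ↦ the partial-block increment — the shape `𝒱_j = Σ_{i ∈ s} T i` that §2 consumes. -/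
theorem klEffectiveAction_eq_sum_towerIncrement (β U μ : ℝ) (K : TrigPolyC4v) (e₀ : ℝ) (d j : ℕ) :
    klEffectiveAction L M β U μ K e₀ j =
      ∑ o : Option (Fin (j / d + 1)),
        Option.elim o (klEffectiveAction L M β U μ K e₀ 0) fun k =>
          if (k : ℕ) < j / d then klEffectiveAction L M β U μ K e₀ (d * ((k : ℕ) + 1)) - klEffectiveAction L M β U μ K e₀ (d * (k : ℕ))
          else klEffectiveAction L M β U μ K e₀ j - klEffectiveAction L M β U μ K e₀ (d * (j / d)) := by
  rw [Fintype.sum_option, Fin.sum_univ_castSucc]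
  simp only [Option.elim, Fin.val_castSucc, Fin.is_lt, if_true, Fin.val_last, lt_irrefl, if_false]
  rw [Fin.sum_univ_eq_sum_range (fun k => klEffectiveAction L M β U μ K e₀ (d * (k + 1)) -
    klEffectiveAction L M β U μ K e₀ (d * k)) (j / d), ← add_assoc]
  exact klEffectiveAction_eq_blocked β U μ K e₀ d j

end Summit.HubbardSuperconductivity.HubbardSuperconductivity.Theorems.EngineV8

end
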